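import Summits.BirchSwinnertonDyer.BirchSwinnertonDyer.Theorems.PrintCf2SplitBadTwoSplitPrimeLineSaturationAnyP
import HarnessLib

/-!
# The `ℤ_p²`-tower over the split-prime lines at EVERY prime `p`: inertia above a split prime is RANK ONE,
# and the tower is UNRAMIFIED above `v̄` over every `ℤ_p`-line in which `v̄` ramifies (e.g. THE line
# unramified outside `v̄`) — `hp2`-free twins of `ZpExtension.toAdd_mul_comm_of_mem_inertia_above` and of
# `inertia_inf_kerSubgroup_le_kerSubgroup_of_isAnticyclotomic` with «anticyclotomic» ↦ «ramified at 𝔓»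

Width seat `bsd-line-cf2-p1-w5` g4 for crux `stmt-BirchSwinnertonDyer-20368` `PrintCf2.SplitBadTwoRankOneOfFacts`
(road α v10.3; route C items 23720 `TwoVariableMainConjAtSplitTwo` ⟶ 23722 `RestrictedMainConjWithValueAtTwo`: the
«push» of Agboola 2007 §4 restricts the two-variable datum over `K̃_∞` to THE `ℤ₂`-line `κ′` unramified outside
`v̄`; the Galois control step along `K̃_∞/K′_∞` at the prime `v̄` needs `K̃_∞/K′_∞` UNRAMIFIED ABOVE `v̄` — the
analogue of the cell bsd-eis input `ZpExtension.inertia_inf_kerSubgroup_le_kerSubgroup_of_isAnticyclotomic`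
("`K̃_∞/K_∞⁻` is unramified above `p`", odd `p` only) for the split-prime lines, at `p = 2`).  Theses-free;
`--supports` the crux.  Sequel of `…SplitPrimeLineSaturationAnyP` (file 1 of brick B18).

The tree's rank-one statement for inertia in the `ℤ_p²`-tower (`ZpExtension.toAdd_mul_comm_of_mem_inertia_above`,
`AnticyclotomicInertiaAboveP` §§1–2) rests on local Kronecker–Weber + the CYCLICITY of `(ℤ/p^m)ˣ`, hence carries
`hp2 : p ≠ 2`.  Here, for `K` imaginary quadratic and `p = v v̄` split, EVERY `p`:

* §1 `toAdd_mul_comm_of_mem_kerSubgroup` — the kernel of ANY `ℤ_p`-quotient `κ` is a LINE of every generator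
  pair: the `2 × 2` minors of the coordinates of `σ, τ ∈ ker κ` vanish (`κ = aκ₁ + bκ₂` with `(a, b) ≠ 0`,
  `GeneratorPairSupply.exists_coeff_of_isTopGeneratorPair`; `ℤ_p` is a domain).
* §2 **`toAdd_mul_comm_of_mem_inertia_above_of_split`** — inertia above `v̄` is RANK ONE in the tower: for `σ ∈ I_𝔓`,
  `τ ∈ I_{𝔓'}`, `𝔓, 𝔓' ∣ v̄` (two primes allowed), `κ₁(σ)κ₂(τ) = κ₂(σ)κ₁(τ)` — both lie in the kernel of THE
  line unramified outside `v` (file 1 §2); `hp2` deleted from the tree's statement.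
* §3 **`inertia_not_le_kerSubgroup_of_isUnramifiedOutside`** — THE `ℤ_p`-extension unramified outside `v̄` is
  ramified at EVERY prime `𝔓 ∣ v̄` of `\bar ℤ_K` (else it is everywhere unramified: file 1 §1); needs no splitting.
* §4 **`inertia_inf_kerSubgroup_le_pairKer_of_not_le`** — for ANY `ℤ_p`-quotient `κ₀` ramified at `𝔓 ∣ v̄`
  (`¬ I_𝔓 ≤ ker κ₀`): `I_𝔓 ⊓ ker κ₀ ≤ pairKer κ₁ κ₂`, i.e. **`K̃_∞ / K₀_∞` is unramified above `𝔓`** (rank one: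
  `q(σ) ∥ q(τ₀)` with `κ₀(τ₀) ≠ 0`, `κ₀(σ) = 0` forces `q(σ) = 0`); and
  **`inertia_inf_kerSubgroup_le_pairKer_of_isUnramifiedOutside`** — the case `κ₀ = κ′` unramified outside `v̄`
  (§3 + §4): `K̃_∞/K′_∞` is unramified above `v̄`.  (Greenberg LNM 1716 §1 p. 53 «`F̃/F_∞` is unramified if `p`
  splits completely» is the case `κ₀ = κ_cyc`.)

THEOREMS ONLY (no `def`, no fact, no `sorry`); nothing is closed; beyond-print theorem: no.  BSD is not proved by
any of this.

References: [Greenberg1978] §4 p. 94; [GreenbergLNM1716] §1 p. 53; [deShalit1987] II.4.17 (p. 77); [Washington1997]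
§13.1, Thm. 13.4; [Agboola2007] §1, §4.
-/

set_option linter.dupNamespace false
set_option autoImplicit false

noncomputable section

open scoped NumberField
open NumberField IsDedekindDomain Field
open Literature Literature.NumberTheory.GaloisRepresentations Literature.NumberTheory.EllipticCurves
open Summit.BirchSwinnertonDyer.BirchSwinnertonDyer.Theorems.PrintCf2

namespace Summit.BirchSwinnertonDyer.BirchSwinnertonDyer.Theorems.PrintCf2.SplitPrimeLine

variable {p : ℕ} [Fact p.Prime] {K : Type} [Field K] [NumberField K]

/-! ### §1. The kernel of a `ℤ_p`-quotient is a line of the tower -/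

/-- **The kernel of any `ℤ_p`-quotient `κ` of `Γ_K` is a LINE of every generator pair** (`K` imaginary
quadratic, any `p`): for `σ, τ ∈ ker κ` the coordinates `(κ₁σ, κ₂σ)`, `(κ₁τ, κ₂τ) ∈ ℤ_p²` are proportional,
`κ₁(σ)·κ₂(τ) = κ₂(σ)·κ₁(τ)`.  (`κ = aκ₁ + bκ₂` with `(a, b) ≠ 0` since `κ` is onto; `ℤ_p` is a domain.)
[cite: Washington1997, Thm. 13.4] [cite: deShalit1987, II.4.13] -/
theorem toAdd_mul_comm_of_mem_kerSubgroup (hK : IsImaginaryQuadratic K)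
    {κ₁ κ₂ : ZpExtension K p} {γ₁ γ₂ : absoluteGaloisGroup K}
    (hpair : ZpExtension.IsTopGeneratorPair κ₁ κ₂ γ₁ γ₂) (κ : ZpExtension K p)
    {σ τ : absoluteGaloisGroup K} (hσ : σ ∈ κ.kerSubgroup) (hτ : τ ∈ κ.kerSubgroup) :
    Multiplicative.toAdd (κ₁ σ) * Multiplicative.toAdd (κ₂ τ) =
      Multiplicative.toAdd (κ₂ σ) * Multiplicative.toAdd (κ₁ τ) := by
  obtain ⟨a, b, hab⟩ := GeneratorPairSupply.exists_coeff_of_isTopGeneratorPair hK.unitsRank_eq_zero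
    hK.nrComplexPlaces_eq_one hpair κ.toContinuousMonoidHom
  simp only [ZpExtension.coe_toContinuousMonoidHom] at hab
  set x : ℤ_[p] := Multiplicative.toAdd (κ₁ σ) with hx_def
  set y : ℤ_[p] := Multiplicative.toAdd (κ₂ σ) with hy_def
  set x' : ℤ_[p] := Multiplicative.toAdd (κ₁ τ) with hx'_def
  set y' : ℤ_[p] := Multiplicative.toAdd (κ₂ τ) with hy'_def
  have hσ0 : a * x + b * y = 0 := by rw [← hab σ, ZpExtension.mem_kerSubgroup.mp hσ, toAdd_one]
  have hτ0 : a * x' + b * y' = 0 := by rw [← hab τ, ZpExtension.mem_kerSubgroup.mp hτ, toAdd_one]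
  -- `(a, b) ≠ 0` since `κ` is onto `ℤ_p`
  have hab0 : ¬ (a = 0 ∧ b = 0) := by
    rintro ⟨rfl, rfl⟩
    obtain ⟨g, hg⟩ := κ.surjective (Multiplicative.ofAdd 1)
    have h := hab g
    rw [ZpExtension.coe_toContinuousMonoidHom] at hg
    rw [hg, toAdd_ofAdd, zero_mul, zero_mul, add_zero] at h
    exact one_ne_zero h
  rcases not_and_or.mp hab0 with ha | hb
  · have : a * (x * y' - y * x') = 0 := by linear_combination y' * hσ0 - y * hτ0
    exact sub_eq_zero.mp ((mul_eq_zero.mp this).resolve_left ha)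
  · have : b * (x * y' - y * x') = 0 := by linear_combination x * hτ0 - x' * hσ0
    exact sub_eq_zero.mp ((mul_eq_zero.mp this).resolve_left hb)

/-! ### §2. Inertia above a split prime is rank one in the `ℤ_p²`-tower, every `p` -/

/-- **Inertia above `v̄` is RANK ONE in the `ℤ_p²`-tower of an imaginary quadratic field at a split prime
`p = v v̄`, EVERY `p`**: for primes `𝔓, 𝔓'` of `\bar ℤ_K` above `v̄` (possibly different) and `σ ∈ I_𝔓`,
`τ ∈ I_{𝔓'}`, the coordinates in any generator pair are proportional, `κ₁(σ)·κ₂(τ) = κ₂(σ)·κ₁(τ)` — both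
elements lie in the kernel of THE `ℤ_p`-extension unramified outside `v` (class field theory,
`ZpExtension.exists_isUnramifiedOutside_of_split`), a line by §1.  The tree's
`ZpExtension.toAdd_mul_comm_of_mem_inertia_above` (local Kronecker–Weber + cyclicity of `(ℤ/p^m)ˣ`) is the case
`𝔓 = 𝔓'`, `p ≠ 2`; here `hp2` is deleted.  The statement above `v` is the same theorem with `v ↔ v̄`.
[cite: Greenberg1978, §4 p. 94] [cite: deShalit1987, II.4.17 (p. 77)] [cite: SerreLocalFields1979, Ch. XIV §7 Thm. 2] -/
theorem toAdd_mul_comm_of_mem_inertia_above_of_split (hK : IsImaginaryQuadratic K)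
    {v vbar : HeightOneSpectrum (𝓞 K)} (hpv : ((p : ℕ) : 𝓞 K) ∈ v.asIdeal)
    (hpvbar : ((p : ℕ) : 𝓞 K) ∈ vbar.asIdeal) (hne : vbar ≠ v)
    {κ₁ κ₂ : ZpExtension K p} {γ₁ γ₂ : absoluteGaloisGroup K}
    (hpair : ZpExtension.IsTopGeneratorPair κ₁ κ₂ γ₁ γ₂)
    {𝔓 𝔓' : Ideal (absIntegers (𝓞 K) K)} (h𝔓 : 𝔓 ∈ vbar.primesAbove) (h𝔓' : 𝔓' ∈ vbar.primesAbove)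
    {σ τ : absoluteGaloisGroup K}
    (hσ : σ ∈ 𝔓.inertia (absoluteGaloisGroup K)) (hτ : τ ∈ 𝔓'.inertia (absoluteGaloisGroup K)) :
    Multiplicative.toAdd (κ₁ σ) * Multiplicative.toAdd (κ₂ τ) =
      Multiplicative.toAdd (κ₂ σ) * Multiplicative.toAdd (κ₁ τ) := by
  obtain ⟨κ, hκ⟩ := ZpExtension.exists_isUnramifiedOutside_of_split (p := p) hK hpv hpvbar hne
  exact toAdd_mul_comm_of_mem_kerSubgroup hK hpair κ
    (inertia_le_kerSubgroup_of_isUnramifiedOutside hκ hne h𝔓 hσ)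
    (inertia_le_kerSubgroup_of_isUnramifiedOutside hκ hne h𝔓' hτ)

/-! ### §3. THE line unramified outside `v̄` is ramified at every prime above `v̄` -/

/-- **THE `ℤ_p`-extension of an imaginary quadratic field unramified outside `v̄` is ramified at EVERY prime
`𝔓 ∣ v̄` of `\bar ℤ_K`** (any `p`, any finite place `v̄`; no splitting needed): if one `I_𝔓 ≤ ker κ′` then every
inertia group above `v̄` lies in `ker κ′` (conjugate primes) and so does every inertia group above `w ≠ v̄`
(`IsUnramifiedOutside`), contradicting file 1 §1 (no everywhere-unramified `ℤ_p`-extension).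
[cite: Brink2007, Cor. 1 (p. 2136), proof] [cite: Washington1997, §13.1 Prop. 13.2] [cite: Agboola2007, §1 p. 1] -/
theorem inertia_not_le_kerSubgroup_of_isUnramifiedOutside (hK : IsImaginaryQuadratic K)
    {vbar : HeightOneSpectrum (𝓞 K)} {κ' : ZpExtension K p} (hκ' : κ'.IsUnramifiedOutside vbar)
    {𝔓 : Ideal (absIntegers (𝓞 K) K)} (h𝔓 : 𝔓 ∈ vbar.primesAbove) :
    ¬ 𝔓.inertia (absoluteGaloisGroup K) ≤ κ'.kerSubgroup := by
  intro hle
  obtain ⟨w, 𝔓', h𝔓', hnot⟩ := exists_inertia_not_le_kerSubgroup hK κ'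
  by_cases hw : w = vbar
  · subst hw
    refine hnot fun τ hτ ↦ ?_
    obtain ⟨τ₀, hτ₀, h1, -⟩ := ZpExtension.exists_mem_inertia_apply_eq κ' κ' h𝔓 h𝔓' hτ
    rw [ZpExtension.mem_kerSubgroup, ← h1]
    exact ZpExtension.mem_kerSubgroup.mp (hle hτ₀)
  · exact hnot (inertia_le_kerSubgroup_of_isUnramifiedOutside hκ' hw h𝔓')

/-! ### §4. The tower is unramified above `v̄` over every line in which `v̄` ramifies -/

/-- **`K̃_∞ / K₀_∞` is unramified above `𝔓` for every `ℤ_p`-line `K₀_∞` ramified at `𝔓 ∣ v̄`** (`K` imaginary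
quadratic, `p = v v̄` split, EVERY `p`): if `¬ I_𝔓 ≤ ker κ₀` then `I_𝔓 ⊓ ker κ₀ ≤ pairKer κ₁ κ₂ = Gal(K̄/K̃_∞)`.
(Rank one, §2: with `τ₀ ∈ I_𝔓`, `κ₀(τ₀) ≠ 0`, and `σ ∈ I_𝔓 ∩ ker κ₀`, the coordinates of `σ` are proportional to
those of `τ₀`; `κ₀ = a₀κ₁ + b₀κ₂` kills `σ` but not `τ₀`, so the coordinates of `σ` vanish.)  The tree's
`ZpExtension.inertia_inf_kerSubgroup_le_kerSubgroup_of_isAnticyclotomic` is the case `κ₀` anticyclotomic, `p` odd;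
Greenberg's «`F̃/F_∞` is unramified if `p` splits completely» the case `κ₀ = κ_cyc`.
[cite: GreenbergLNM1716, §1 p. 53] [cite: Greenberg1978, §4 p. 94] [cite: Washington1997, Thm. 13.4] -/
theorem inertia_inf_kerSubgroup_le_pairKer_of_not_le (hK : IsImaginaryQuadratic K)
    {v vbar : HeightOneSpectrum (𝓞 K)} (hpv : ((p : ℕ) : 𝓞 K) ∈ v.asIdeal)
    (hpvbar : ((p : ℕ) : 𝓞 K) ∈ vbar.asIdeal) (hne : vbar ≠ v)
    {κ₁ κ₂ : ZpExtension K p} {γ₁ γ₂ : absoluteGaloisGroup K}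
    (hpair : ZpExtension.IsTopGeneratorPair κ₁ κ₂ γ₁ γ₂) {κ₀ : ZpExtension K p}
    {𝔓 : Ideal (absIntegers (𝓞 K) K)} (h𝔓 : 𝔓 ∈ vbar.primesAbove)
    (hram : ¬ 𝔓.inertia (absoluteGaloisGroup K) ≤ κ₀.kerSubgroup) :
    𝔓.inertia (absoluteGaloisGroup K) ⊓ κ₀.kerSubgroup ≤ ZpExtension.pairKer κ₁ κ₂ := by
  intro σ hσ
  obtain ⟨hσI, hσ0⟩ := Subgroup.mem_inf.mp hσ
  -- an inertia element not killed by `κ₀`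
  obtain ⟨τ₀, hτ₀, hτ₀ne⟩ : ∃ τ₀ ∈ 𝔓.inertia (absoluteGaloisGroup K), κ₀ τ₀ ≠ 1 := by
    by_contra h
    push Not at h
    exact hram fun τ hτ ↦ ZpExtension.mem_kerSubgroup.mpr (h τ hτ)
  -- coordinates
  obtain ⟨a, b, hab⟩ := GeneratorPairSupply.exists_coeff_of_isTopGeneratorPair hK.unitsRank_eq_zero
    hK.nrComplexPlaces_eq_one hpair κ₀.toContinuousMonoidHom
  simp only [ZpExtension.coe_toContinuousMonoidHom] at hab
  set x : ℤ_[p] := Multiplicative.toAdd (κ₁ σ) with hx_def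
  set y : ℤ_[p] := Multiplicative.toAdd (κ₂ σ) with hy_def
  set s : ℤ_[p] := Multiplicative.toAdd (κ₁ τ₀) with hs_def
  set t : ℤ_[p] := Multiplicative.toAdd (κ₂ τ₀) with ht_def
  have hprop : x * t = y * s := toAdd_mul_comm_of_mem_inertia_above_of_split hK hpv hpvbar hne hpair h𝔓 h𝔓 hσI hτ₀
  have hσ0' : a * x + b * y = 0 := by rw [← hab σ, ZpExtension.mem_kerSubgroup.mp hσ0, toAdd_one]
  have hc : a * s + b * t ≠ 0 := by
    intro h0
    apply hτ₀ne
    rw [← ofAdd_toAdd (κ₀ τ₀), hab τ₀, ← hs_def, ← ht_def, h0, ofAdd_zero]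
  have hx : x = 0 := by
    have : (a * s + b * t) * x = 0 := by linear_combination s * hσ0' + b * hprop
    exact (mul_eq_zero.mp this).resolve_left hc
  have hy : y = 0 := by
    have : (a * s + b * t) * y = 0 := by linear_combination t * hσ0' - a * hprop
    exact (mul_eq_zero.mp this).resolve_left hc
  refine ZpExtension.mem_pairKer_iff.mpr ⟨?_, ?_⟩
  · rw [← ofAdd_toAdd (κ₁ σ), ← hx_def, hx, ofAdd_zero]
  · rw [← ofAdd_toAdd (κ₂ σ), ← hy_def, hy, ofAdd_zero]

/-- **`K̃_∞ / K′_∞` is unramified above `v̄`, for THE `ℤ_p`-extension `K′_∞` unramified outside `v̄`** (`K`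
imaginary quadratic, `p = v v̄` split, EVERY `p`; the split-prime analogue of "`K̃_∞/K_∞⁻` is unramified above
`p`"): `I_𝔓 ⊓ ker κ′ ≤ pairKer κ₁ κ₂` for every prime `𝔓 ∣ v̄` of `\bar ℤ_K` (§3 + §4).  Input of the Galois
control step along `K̃_∞/K′_∞` at `v̄` in the descent of a two-variable datum to the `v̄`-line.
[cite: GreenbergLNM1716, §1 p. 53] [cite: Agboola2007, §1 p. 1, §4] [cite: deShalit1987, II.4.17 (p. 77)] -/
theorem inertia_inf_kerSubgroup_le_pairKer_of_isUnramifiedOutside (hK : IsImaginaryQuadratic K)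
    {v vbar : HeightOneSpectrum (𝓞 K)} (hpv : ((p : ℕ) : 𝓞 K) ∈ v.asIdeal)
    (hpvbar : ((p : ℕ) : 𝓞 K) ∈ vbar.asIdeal) (hne : vbar ≠ v)
    {κ₁ κ₂ : ZpExtension K p} {γ₁ γ₂ : absoluteGaloisGroup K}
    (hpair : ZpExtension.IsTopGeneratorPair κ₁ κ₂ γ₁ γ₂)
    {κ' : ZpExtension K p} (hκ' : κ'.IsUnramifiedOutside vbar)
    {𝔓 : Ideal (absIntegers (𝓞 K) K)} (h𝔓 : 𝔓 ∈ vbar.primesAbove) :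
    𝔓.inertia (absoluteGaloisGroup K) ⊓ κ'.kerSubgroup ≤ ZpExtension.pairKer κ₁ κ₂ :=
  inertia_inf_kerSubgroup_le_pairKer_of_not_le hK hpv hpvbar hne hpair h𝔓
    (inertia_not_le_kerSubgroup_of_isUnramifiedOutside hK hκ' h𝔓)

end Summit.BirchSwinnertonDyer.BirchSwinnertonDyer.Theorems.PrintCf2.SplitPrimeLine

end
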